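import Literature.NumberTheory.EllipticCurves.Tian2014.CMPointSystemBridgeParam
import HarnessLib

/-!
# The sign relation «`T(B) = [±i]`» (display M4 of the maximal bridge, PROOF-A (8.1.2) second sentence) as a KERNEL
# THEOREM of Tian's printed sentences on the automorphism group of `E′_ℂ = (X₀(32), [∞])_ℂ`: «the action of `N` on
# `ℋ ∪ ℙ¹(ℚ)` induces `T : N → Aut(X₀(32)(ℂ), S)`», «`T(B) ∈ Aut(E′_ℂ)` is an automorphism of `E′_ℂ` of exact order 4»,
# «`T(B²)` is the multiplication by `−1`», «`Aut(E′_ℂ) ≅ ℤ[i]^×`», «`E′_ℂ` has complex multiplication by `ℤ[i]`»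

Cell `bsd-monsky` (typer seat, g6; referee B ROUND 253: the route-A marks of record are the three READINGS `fEqPhi`,
`tianTB`, `tyzZN`, each «one line from print»; R249.1: a displayed sentence that is not printed carries a mark, a kernel
theorem of printed sentences does not; `fEqPhi` was split in `CMPointSystemBridgeParam.lean`). HONEST FRAMING: nothing
asserted; every `def … : Prop` below is a displayed sentence of Tian 2014 (`pNNNN LMM` = page:line of the materialised
arXiv text, `J` = journal page) on abstract DATA, and the kernel theorem is elementary group theory in the unit group of
the endomorphism ring of the group `E′(ℂ)`.

## The datum: Tian's `T(B)` and the notion «automorphism of the elliptic curve `E′_ℂ`»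

Tian p0006 L32–L35: «the action of `N ⊂ GL₂⁺(ℝ)` on `ℋ ∪ ℙ¹(ℚ)` induces a homomorphism `T : N → Aut(X₀(32)(ℂ), S)` with
kernel `Z(ℝ)Γ₀(32)`»; p0006 L37–L40: «every element of `Aut(X₀(32)(ℂ))` is of form `t_{α,ǫ}(x) = ǫ(x) + α`, where `ǫ`
belongs to the group `Aut(E′_ℂ)` of automorphisms of the elliptic curve `E′_ℂ` (i.e. ones with `ǫ([∞]) = [∞]`)». The
automorphism `T(B)` of `X₀(32)(ℂ)` fixes `[∞]` (p0006 L62), so it is an automorphism of the elliptic curve `E′_ℂ`, in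
particular an invertible endomorphism of the group `A = E′(ℂ)` (an isogeny is a group homomorphism, Silverman III.4.8 —
the same convention as the fields `f`, `phi`, `iota` of `BridgeData`): it is recorded as a UNIT `tB` of the endomorphism
ring `AddMonoid.End A`, and the notion «`g ∈ Aut(E′_ℂ)`» (automorphism of the elliptic curve, not merely of the group of
complex points) as an abstract predicate `IsCurveAut` on those units; nothing about either is asserted beyond the five
displayed sentences.

## The displays (one printed sentence each; all Tian 2014, Prop. 2.1 and the paragraph after its proof)

* `tianTDef` — «the action of `N ⊂ GL₂⁺(ℝ)` on `ℋ ∪ ℙ¹(ℚ)` induces a homomorphism `T : N → Aut(X₀(32)(ℂ), S)`»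
  (p0006 L32–L35 = J124 L34–L38): `T(B)[z] = [B·z]` for `z ∈ ℋ` (displayed on `ℋ` only).
* `tianTBAut` — «Also `T(B)` maps `[∞]` to itself. Thus `T(B) ∈ Aut(E′_ℂ)` is an automorphism of `E′_ℂ` of exact order 4»
  (p0006 L62–L64 = J125 L24–L27; again p0007 L28–L29 = J126 L5–L7 «`T(B) ∈ Aut(E′_ℂ)` is of order 4»): `T(B) ∈ Aut(E′_ℂ)` and
  `orderOf T(B) = 4`.
* `tianTBSq` — «As `T(B²)` is the multiplication by `−1`» (p0006 L72–L73 = J125 L33–L34; `T` a homomorphism): `T(B)∘T(B) = −1`.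
* `tianAutUnits` — «Now we have that `Aut(E′_ℂ) ≅ ℤ[i]^×`» (p0007 L28 = J126 L5–L6): the group `Aut(E′_ℂ)` is isomorphic to
  the unit group of the Gaussian integers.
* `tianCM` — «The elliptic curve `E′ = (X₀(32), ∞)` has complex multiplication by `ℤ[i]`» (Prop. 2.1, p0006 L25–L26 =
  J124 L25–L26; «proving that `E′_ℂ` has complex multiplication by `ℤ[i]`», p0006 L65–L66 = J125 L26–L27): the complex multiplication `[i]` (the field
  `iota` of `BridgeData`) is an automorphism of the elliptic curve `E′_ℂ` with `[i]∘[i] = [−1]`.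

## The kernel content

`tianTB_of_autDisplays`: in `Aut(E′_ℂ) ≅ ℤ[i]^× = {1, −1, i, −i}` both `T(B)` and `[i]` have order `4` (`T(B)` by display,
`[i]` because `[i]² = −1 ≠ 1` — `T(B)² = −1` and `T(B)² ≠ 1`), and the two elements of order `4` of `ℤ[i]^×` are inverse to
each other; so `T(B) = [i]` or `T(B) = [i]⁻¹ = [−i]`, i.e. `[B·z] = [±i]·[z]` — display M4 `tianTB`. Then
`ParamCuspDisplays` follows from `AutDisplays` (M4 replaced by the five sentences), `GrossZagierAut ⟹ GrossZagierParam`,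
and the restated fact `tian2014_system_sMinus_aut` implies `tian2014_system_sMinus_param`, hence `…_cusp`, `…_maximal` and
every enclosure form of C-P2-1. The whole enclosure is invariant under `[i] ↔ [−i]` (M4, M5 carry a sign; `1 − [i] =
[−i]∘(1 + [i])` for C2; M7 is symmetric), so no normalisation of `[i]` is displayed or needed. Nothing booked; no mark moved
by this file alone. [cite: Tian2014, Prop. 2.1 (p0006 L23–L27) and its proof (p0006 L28–L75), p0007 L22–L33 (J126 L2–L11)]
[cite: SilvermanAEC2009, Thm. III.4.8, Thm. III.10.1 (the printed sentence «`Aut(E′_ℂ) ≅ ℤ[i]^×`» is Tian's own)]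
-/

noncomputable section

open scoped Classical

open WeierstrassCurve NumberField Literature.NumberTheory.EllipticCurves
  Literature.NumberTheory.EllipticCurves.TianYuanZhang2017

namespace Literature.NumberTheory.EllipticCurves.Tian2014

/-! ## §0 Kernel arithmetic in `ℤ[i]^×` (no display): the units of the Gaussian integers are `1, −1, i, −i` -/

/-- The units of `ℤ[i]` are `1`, `−1`, `i = ⟨0, 1⟩`, `−i = ⟨0, −1⟩` (norm `1`). Kernel helper, restating
`Literature.NumberTheory.LFunctions.GaussianHeckeClassOneMollified.mem_fourUnits_iff` in the form used here (that module
is not imported: its L-function import closure has nothing to do with Tian 2014). [folklore] -/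
private theorem gaussianInt_units_cases (u : GaussianIntˣ) :
    (u : GaussianInt) = 1 ∨ (u : GaussianInt) = -1 ∨ (u : GaussianInt) = ⟨0, 1⟩ ∨
      (u : GaussianInt) = ⟨0, -1⟩ := by
  have hn : (u : GaussianInt).norm = 1 := (Zsqrtd.norm_eq_one_iff' (by norm_num) _).mpr u.isUnit
  rcases hu : (u : GaussianInt) with ⟨a, b⟩
  rw [hu, Zsqrtd.norm_def] at hn
  have ha : a * a ≤ 1 := by nlinarith [mul_self_nonneg b]
  have hb : b * b ≤ 1 := by nlinarith [mul_self_nonneg a]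
  obtain ⟨ha1, ha2⟩ := abs_le.mp (abs_le_one_iff_mul_self_le_one.mpr ha)
  obtain ⟨hb1, hb2⟩ := abs_le.mp (abs_le_one_iff_mul_self_le_one.mpr hb)
  interval_cases a <;> interval_cases b <;> simp_all [Zsqrtd.ext_iff]

/-- In `ℤ[i]^×`, a unit that is neither `1` nor `−1` has `u² = −1`; two such units are equal or inverse to each other:
if `u, v ∈ {i, −i}` then `u = v` or `u * v = 1`. [folklore] -/
private theorem gaussianInt_units_eq_or_mul_eq_one {u v : GaussianIntˣ}
    (hu1 : (u : GaussianInt) ≠ 1) (hu2 : (u : GaussianInt) ≠ -1)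
    (hv1 : (v : GaussianInt) ≠ 1) (hv2 : (v : GaussianInt) ≠ -1) : u = v ∨ u * v = 1 := by
  rcases gaussianInt_units_cases u with hu | hu | hu | hu
  · exact absurd hu hu1
  · exact absurd hu hu2
  · rcases gaussianInt_units_cases v with hv | hv | hv | hv
    · exact absurd hv hv1
    · exact absurd hv hv2
    · exact Or.inl (Units.ext (hu.trans hv.symm))
    · refine Or.inr (Units.ext ?_)
      rw [Units.val_mul, hu, hv, Units.val_one]
      ext <;> simp [Zsqrtd.re_mul, Zsqrtd.im_mul]
  · rcases gaussianInt_units_cases v with hv | hv | hv | hv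
    · exact absurd hv hv1
    · exact absurd hv hv2
    · refine Or.inr (Units.ext ?_)
      rw [Units.val_mul, hu, hv, Units.val_one]
      ext <;> simp [Zsqrtd.re_mul, Zsqrtd.im_mul]
    · exact Or.inl (Units.ext (hu.trans hv.symm))

namespace CMPointData

variable {n : ℕ}

namespace BridgeData

variable {D : CMPointData n} (B : D.BridgeData)

/-! ## §1 The datum: Tian's `T(B)` and the predicate «automorphism of the elliptic curve `E′_ℂ`» -/

/-- **Tian's `T(B)` and the notion «`g ∈ Aut(E′_ℂ)`» as data** (objects only; nothing asserted): `T(B)`, an automorphism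
of `X₀(32)(ℂ)` fixing `[∞]`, as a unit of the endomorphism ring of the group `A = E′(ℂ)`; and an abstract predicate on
such units, holding of the automorphisms of the ELLIPTIC CURVE `E′_ℂ` (p0006 L37–L40: «the group `Aut(E′_ℂ)` of
automorphisms of the elliptic curve `E′_ℂ` (i.e. ones with `ǫ([∞]) = [∞]`)»).
[cite: Tian2014, Prop. 2.1 proof (p0006 L28–L42 = J124 L30–J125 L3, p0006 L60–L64 = J125 L23–L27), p0007 L22–L29 (J126 L2–L7)] [cite: SilvermanAEC2009, Thm. III.4.8] -/
structure AutData : Type where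
  /-- Tian's `T(B) ∈ Aut(X₀(32)(ℂ), S)`, `[∞] ↦ [∞]`, as an invertible endomorphism of the group `E′(ℂ)` -/
  tB : (AddMonoid.End B.A)ˣ
  /-- «`g ∈ Aut(E′_ℂ)`»: `g` is an automorphism of the elliptic curve `E′_ℂ` (on complex points) -/
  IsCurveAut : (AddMonoid.End B.A)ˣ → Prop

namespace AutData

variable {B} (Q : B.AutData)

/-! ## §2 The displays -/

/-- **«The action of `N ⊂ GL₂⁺(ℝ)` on `ℋ ∪ ℙ¹(ℚ)` induces a homomorphism `T : N → Aut(X₀(32)(ℂ), S)`»** — the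
automorphism `T(B)` acts on `X₀(32)(ℂ) = Γ₀(32)\(ℋ ∪ ℙ¹(ℚ))` through the action of the matrix `B` on `ℋ`: `T(B)[z] = [B·z]`
(displayed for `z ∈ ℋ`). [cite: Tian2014, Prop. 2.1 proof (p0006 L32–L35 = J124 L34–L38; the matrix `B` p0006 L43–L48 = J125 L4–L11)] -/
def tianTDef : Prop :=
  ∀ z : ℂ, 0 < z.im → B.cm (moebius matB z) = (Q.tB : AddMonoid.End B.A) (B.cm z)

/-- **«Also `T(B)` maps `[∞]` to itself. Thus `T(B) ∈ Aut(E′_ℂ)` is an automorphism of `E′_ℂ` of exact order 4»** (and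
«`T(B) ∈ Aut(E′_ℂ)` is of order 4», p0007 L28–L29). [cite: Tian2014, Prop. 2.1 proof (p0006 L60–L64 = J125 L23–L27), p0007 L28–L29 (J126 L5–L7)] -/
def tianTBAut : Prop :=
  Q.IsCurveAut Q.tB ∧ orderOf Q.tB = 4

/-- **«As `T(B²)` is the multiplication by `−1`»** (`T` is a homomorphism, so `T(B²) = T(B)∘T(B)`).
[cite: Tian2014, Prop. 2.1 proof (p0006 L32–L35 = J124 L34–L38, p0006 L72–L73 = J125 L33–L34)] -/
def tianTBSq : Prop :=
  ∀ x : B.A, (Q.tB : AddMonoid.End B.A) ((Q.tB : AddMonoid.End B.A) x) = -x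

/-- **«Now we have that `Aut(E′_ℂ) ≅ ℤ[i]^×`»** — the group of automorphisms of the elliptic curve `E′_ℂ` (a subgroup of
the unit group of the endomorphism ring of `E′(ℂ)`) is isomorphic to the unit group of the Gaussian integers.
[cite: Tian2014, p0007 L28–L29 (J126 L5–L7)] -/
def tianAutUnits : Prop :=
  ∃ S : Subgroup (AddMonoid.End B.A)ˣ, (∀ g, g ∈ S ↔ Q.IsCurveAut g) ∧ Nonempty (S ≃* GaussianIntˣ)

/-- **«The elliptic curve `E′ = (X₀(32), ∞)` has complex multiplication by `ℤ[i]`»** (Prop. 2.1; «proving that `E′_ℂ` has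
complex multiplication by `ℤ[i]`», p0006 L65–L66) — the complex multiplication `[i]` (the field `iota` of `BridgeData`,
«the complex multiplication `[i]` of `E′`») is an automorphism of the elliptic curve `E′_ℂ` with `[i]∘[i] = [i²] = [−1]`.
[cite: Tian2014, Prop. 2.1 (p0006 L25–L26 = J124 L25–L26), its proof (p0006 L64–L66 = J125 L25–L27)] -/
def tianCM : Prop :=
  ∃ ι : (AddMonoid.End B.A)ˣ, Q.IsCurveAut ι ∧ (∀ x, (ι : AddMonoid.End B.A) x = B.iota x) ∧
    ∀ x, (ι : AddMonoid.End B.A) ((ι : AddMonoid.End B.A) x) = -x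

/-- The five printed sentences together. [cite: Tian2014, Prop. 2.1 (p0006 L23–L75), p0007 L22–L29] -/
def AutDisplays : Prop :=
  Q.tianTDef ∧ Q.tianTBAut ∧ Q.tianTBSq ∧ Q.tianAutUnits ∧ Q.tianCM

/-! ## §3 The kernel content: M4 is a theorem of the five sentences -/

/-- In `Aut(E′_ℂ) ≅ ℤ[i]^×`, an element of order `4` maps to a unit that is neither `1` nor `−1`. [folklore] -/
private theorem coe_ne_one_and_ne_neg_one_of_orderOf_eq_four {S : Subgroup (AddMonoid.End B.A)ˣ}
    (e : S ≃* GaussianIntˣ) (t : S) (ht : orderOf t = 4) :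
    ((e t : GaussianIntˣ) : GaussianInt) ≠ 1 ∧ ((e t : GaussianIntˣ) : GaussianInt) ≠ -1 := by
  have hord : orderOf (e t) = 4 := by
    rw [← ht]; exact orderOf_injective e.toMonoidHom e.injective t
  constructor
  · intro h1
    have : e t = 1 := Units.ext h1
    rw [this, orderOf_one] at hord
    exact absurd hord (by norm_num)
  · intro h2
    have hsq : (e t) ^ 2 = 1 := by
      apply Units.ext
      rw [Units.val_pow_eq_pow_val, h2, Units.val_one]
      ring
    have : orderOf (e t) ∣ 2 := orderOf_dvd_iff_pow_eq_one.mpr hsq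
    rw [hord] at this
    exact absurd this (by norm_num)

/-- **Display M4 of the maximal bridge (`T(B) = [±i]`, PROOF-A (8.1.2) second sentence) is a KERNEL THEOREM of the five
printed sentences**: `T(B)` and `[i]` are elements of order `4` of `Aut(E′_ℂ) ≅ ℤ[i]^× = {1, −1, i, −i}`, hence equal or
inverse to each other; `[i]⁻¹ = [−i]`. [cite: Tian2014, Prop. 2.1 (p0006 L23–L75), p0007 L28–L29] -/
theorem tianTB_of_autDisplays (h : Q.AutDisplays) : B.tianTB := by
  obtain ⟨hT, ⟨hTaut, hTord⟩, hTsq, ⟨S, hS, ⟨e⟩⟩, ⟨ι, hιaut, hιeq, hιsq⟩⟩ := h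
  -- the two elements of `S`
  set t : S := ⟨Q.tB, (hS _).2 hTaut⟩ with ht_def
  set j : S := ⟨ι, (hS _).2 hιaut⟩ with hj_def
  have ht : orderOf t = 4 := by rw [ht_def, Subgroup.orderOf_mk]; exact hTord
  -- `−1 ≠ 1` on `A`, from `T(B)² = −1` and `T(B)² ≠ 1`
  have hTsq' : (Q.tB : (AddMonoid.End B.A)ˣ) ^ 2 ≠ 1 := by
    intro h2
    have : orderOf Q.tB ∣ 2 := orderOf_dvd_iff_pow_eq_one.mpr h2
    rw [hTord] at this
    exact absurd this (by norm_num)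
  have hneg : ∃ x : B.A, -x ≠ x := by
    by_contra hcon
    have hcon' : ∀ x : B.A, -x = x := fun x => by
      by_contra hx
      exact hcon ⟨x, hx⟩
    apply hTsq'
    apply Units.ext
    rw [Units.val_pow_eq_pow_val, Units.val_one]
    apply AddMonoid.End.ext
    intro x
    rw [pow_two, AddMonoid.End.coe_mul, Function.comp_apply, hTsq x, hcon' x, AddMonoid.End.coe_one, id_eq]
  -- `[i]` has order `4` as well: `j ≠ 1` and `j² ≠ 1`
  have hj1 : (ι : (AddMonoid.End B.A)ˣ) ^ 2 ≠ 1 := by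
    intro h2
    obtain ⟨x, hx⟩ := hneg
    apply hx
    have := congrArg (fun g : (AddMonoid.End B.A)ˣ => (g : AddMonoid.End B.A) x) h2
    simp only [Units.val_pow_eq_pow_val, Units.val_one, AddMonoid.End.coe_one, id_eq] at this
    rw [pow_two, AddMonoid.End.coe_mul, Function.comp_apply, hιsq x] at this
    exact this
  have hjS : orderOf j = 4 ∨ (j ≠ 1 ∧ j ^ 2 ≠ 1) := by
    right
    constructor
    · intro h1
      apply hj1
      have : (ι : (AddMonoid.End B.A)ˣ) = 1 := by
        have := congrArg (fun s : S => (s : (AddMonoid.End B.A)ˣ)) h1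
        simpa [hj_def] using this
      rw [this, one_pow]
    · intro h2
      apply hj1
      have := congrArg (fun s : S => (s : (AddMonoid.End B.A)ˣ)) h2
      simpa [hj_def] using this
  -- in `ℤ[i]^×`, `e t` and `e j` are neither `1` nor `−1`
  obtain ⟨hu1, hu2⟩ := coe_ne_one_and_ne_neg_one_of_orderOf_eq_four e t ht
  have hv : ((e j : GaussianIntˣ) : GaussianInt) ≠ 1 ∧ ((e j : GaussianIntˣ) : GaussianInt) ≠ -1 := by
    rcases hjS with hj4 | ⟨hjne, hjsq⟩
    · exact coe_ne_one_and_ne_neg_one_of_orderOf_eq_four e j hj4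
    constructor
    · intro h1
      apply hjne
      apply e.injective
      rw [map_one]
      exact Units.ext h1
    · intro h2
      apply hjsq
      apply e.injective
      rw [map_pow, map_one]
      apply Units.ext
      rw [Units.val_pow_eq_pow_val, h2, Units.val_one]
      ring
  obtain ⟨hv1, hv2⟩ := hv
  -- `t = j` or `t * j = 1`
  rcases gaussianInt_units_eq_or_mul_eq_one hu1 hu2 hv1 hv2 with heq | hmul
  · -- `T(B) = [i]`
    have htj : t = j := e.injective heq
    have hTι : (Q.tB : AddMonoid.End B.A) = (ι : AddMonoid.End B.A) := by
      have := congrArg (fun s : S => ((s : (AddMonoid.End B.A)ˣ) : AddMonoid.End B.A)) htj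
      simpa [ht_def, hj_def] using this
    refine ⟨1, Or.inl rfl, fun z hz => ?_⟩
    rw [hT z hz, hTι, hιeq, one_smul]
  · -- `T(B)∘[i] = 1`, so `T(B) = [i]⁻¹ = [−i]`
    have htj : t * j = 1 := by
      apply e.injective
      rw [map_mul, map_one]
      exact hmul
    have hTι : ∀ x, (Q.tB : AddMonoid.End B.A) ((ι : AddMonoid.End B.A) x) = x := by
      intro x
      have := congrArg (fun s : S => ((s : (AddMonoid.End B.A)ˣ) : AddMonoid.End B.A) x) htj
      simpa [ht_def, hj_def, AddMonoid.End.coe_mul] using this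
    refine ⟨-1, Or.inr rfl, fun z hz => ?_⟩
    have key : ∀ x, (Q.tB : AddMonoid.End B.A) x = -B.iota x := by
      intro x
      have h1 := hTι ((ι : AddMonoid.End B.A) x)
      rw [hιsq x, map_neg] at h1
      rw [← hιeq x, ← h1, neg_neg]
    rw [hT z hz, key, neg_smul, one_smul]

end AutData

/-! ## §4 The seven displays with M2, M4 and M7 all split into printed sentences -/

/-- **The maximal displays with M2, M4 and M7 split into print**: M1, M3, M5, M6 of `CMPointSystemBridgeMaximal.lean`
unchanged; in place of `f = ±ϕ` the predicate datum of `CMPointSystemBridgeParam.lean` with its three printed sentences;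
in place of `T(B) = [±i]` Tian's `T(B)` and the predicate «automorphism of the elliptic curve `E′_ℂ`» with the five printed
sentences (`AutDisplays`); in place of `2·ϕ([i][0]) = 0` TYZ's `τ` with its two printed sentences (`TauDisplays`).
[cite: Tian2014, Def. 2.7, Prop. 2.1 (p0006 L23–L75), p0007 L28–L29, p0003 L1–L5, §2 (p0005 L77–L79)]
[cite: TianYuanZhang2017, §2 (p0007 L112), §3.1, §3.2 (p0012 L16), J747, J751, Lemma 3.16 (p0017 L111)] -/
def AutParamCuspDisplays (w : EPoint D.H) : Prop :=
  B.tianDefZ ∧ (∃ Q : B.ParamData, Q.ParamDisplays) ∧ B.tianTA ∧ (∃ R : B.AutData, R.AutDisplays) ∧ B.tyzZN ∧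
    B.wEqPhiZN w ∧ ∃ C : B.TauData, C.TauDisplays

/-- `AutParamCuspDisplays ⟹ ParamCuspDisplays` (M4 is a theorem of the five printed sentences).
[cite: Tian2014, Prop. 2.1 (p0006 L23–L75), p0007 L28–L29] -/
theorem paramCuspDisplays_of_autParamCuspDisplays {w : EPoint D.H} (h : B.AutParamCuspDisplays w) :
    B.ParamCuspDisplays w := by
  obtain ⟨h1, h2, h3, ⟨R, hR⟩, h5, h6, hC⟩ := h
  exact ⟨h1, h2, h3, R.tianTB_of_autDisplays hR, h5, h6, hC⟩

end BridgeData

/-! ## §5 The Gross–Zagier relation with the split displays, and the restated system fact -/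

/-- **The Gross–Zagier index relation with M2, M4 and M7 split into printed sentences**: as `GrossZagierParam` (TYZ
Thm. 3.3 at `χ₀`, (B1) TYZ p. 749 through `ϕ`) with `ParamCuspDisplays` replaced by `AutParamCuspDisplays`.
[cite: TianYuanZhang2017, Thm. 3.3 (p. 739), p. 749, J751, §2 (p0007 L112), §3.2, Lemma 3.16]
[cite: Tian2014, Def. 2.7, Prop. 2.1 (p0006 L23–L75), p0007 L28–L29, p0003 L1–L5] -/
def GrossZagierAut (D : CMPointData n) (hn : n ≠ 0) : Prop :=
  ∃ (R : EPoint D.H) (L u : ℤ) (h₂ : ℕ) (w : EPoint D.H) (B : D.BridgeData), IsScriptL (2 * n) L ∧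
    IsScriptL 1 u ∧ Odd u ∧ D.tyzThm33Chi0 hn R L u h₂ ∧ D.tyzTwoRSum R w ∧ B.AutParamCuspDisplays w

/-- `GrossZagierAut ⟹ GrossZagierParam`. [cite: Tian2014, Prop. 2.1 (p0006 L23–L75), p0007 L28–L29] -/
theorem grossZagierParam_of_grossZagierAut (D : CMPointData n) (hn : n ≠ 0) (h : D.GrossZagierAut hn) :
    D.GrossZagierParam hn := by
  obtain ⟨R, L, u, h₂, w, B, hL, hu, huodd, h33, hB1, hP⟩ := h
  exact ⟨R, L, u, h₂, w, B, hL, hu, huodd, h33, hB1, B.paramCuspDisplays_of_autParamCuspDisplays hP⟩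

end CMPointData

/-- **THE SYSTEM FACT WITH M2, M4 AND M7 SPLIT INTO PRINTED SENTENCES**: Tian's CM-point system on `𝒮⁻` with `Printed`
(Thm. 2.8 system), `GrossZagierAut` (TYZ Thm. 3.3 at `χ₀` + TYZ p. 749 through `ϕ` + the displays M1, M3, M5, M6 + the
predicate «degree-`2` modular parametrisation mapping `[∞]` to `0`» with its three printed sentences + Tian's `T(B)` and the
predicate «automorphism of the elliptic curve `E′_ℂ`» with «`T` induced by the action of `N` on `ℋ ∪ ℙ¹(ℚ)`», «`T(B) ∈
Aut(E′_ℂ)` … of exact order 4», «`T(B²)` is the multiplication by `−1`», «`Aut(E′_ℂ) ≅ ℤ[i]^×`», «`E′_ℂ` has complex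
multiplication by `ℤ[i]`» + TYZ's `τ` with «`τ(1/2) = [0]`» and «`ϕ_F` and `[1+i]` have the same kernel `{0, τ(1)}`» +
`𝓛(2n) ∈ ℤ`, `𝓛(1)` odd) and `GenusTheoryDisplays`. Existential over ONE system per `(p, q)`; implies
`tian2014_system_sMinus_param` (`tian2014_system_sMinus_param_of_aut`), hence `…_cusp`, `…_maximal`, `…_bridged`, `…_split`,
`…_genus` and every enclosure form of the cell. Printed-but-unproved content = that of the param fact with the sign relation
`T(B) = [±i]` replaced by the five printed sentences of Tian p0006–p0007.
[cite: Tian2014, Def. 2.7, Thm. 2.8 (p0011 L25–L44 = J132), Prop. 2.1 (p0006 L23–L75 = J124 L25–J125 L35), p0007 L22–L29 (J126 L2–L7), p0003 L1–L5, §2 (p0005 L77–L79), (4.8) (p0023 L46–L50), Notations (J122–123)]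
[cite: TianYuanZhang2017, Thm. 3.3 (p. 739) and its proof (pp. 749–751), §2 (p0007 L112), §3.1, §3.2 (p0012 L8–L18), J747, J751, Lemma 3.16 (p0017 L98–L113), Thm. 1.1, Thm. 1.4] -/
def tian2014_system_sMinus_aut : Prop :=
  ∀ p q : ℕ, (hp : p.Prime) → (hq : q.Prime) → p % 8 = 5 → q % 4 = 3 → jacobiSym p q = -1 →
    ∃ D : CMPointData (p * q), D.Printed ∧
      D.GrossZagierAut (Nat.mul_ne_zero hp.ne_zero hq.ne_zero) ∧ D.GenusTheoryDisplays

/-- The aut fact implies the param fact (M4 is a kernel theorem of Tian's five printed sentences).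
[cite: Tian2014, Prop. 2.1 (p0006 L23–L75), p0007 L28–L29] -/
theorem tian2014_system_sMinus_param_of_aut (h : tian2014_system_sMinus_aut) :
    tian2014_system_sMinus_param := by
  intro p q hp hq hp5 hq4 hj
  obtain ⟨D, hP, hG, hGen⟩ := h p q hp hq hp5 hq4 hj
  exact ⟨D, hP, D.grossZagierParam_of_grossZagierAut _ hG, hGen⟩

/-- The aut fact implies the maximal fact. [cite: Tian2014, Prop. 2.1, p0003 L3–L5, p0007 L28–L29] [cite: TianYuanZhang2017, §2, §3.2, Lemma 3.16] -/
theorem tian2014_system_sMinus_maximal_of_aut (h : tian2014_system_sMinus_aut) :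
    tian2014_system_sMinus_maximal :=
  tian2014_system_sMinus_maximal_of_param (tian2014_system_sMinus_param_of_aut h)

end Literature.NumberTheory.EllipticCurves.Tian2014

end
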